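import Literature.NumberTheory.DiophantineApproximation.GeneralizedPolynomialsUD
import Literature.NumberTheory.DiophantineApproximation.WeylCriterionArcs
import Mathlib.Analysis.SpecialFunctions.Integrals.Basic
import Mathlib.Analysis.SpecialFunctions.Complex.Log
import Mathlib.Topology.UniformSpace.HeineCantor
import Mathlib.NumberTheory.Real.Irrational
import HarnessLib

/-!
# Uniform distribution mod 1 of `[αn]β`: proof of the `k = 1` criterion (discharge of `Haland1994_bracketLinear_iff`)

Topic `Literature/NumberTheory/DiophantineApproximation`. This file PROVES
`theorem Haland1994_bracketLinear_iff_holds : Haland1994_bracketLinear_iff`, discharging the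
named fact of `GeneralizedPolynomialsUD.lean`:

  for irrational `α`, the sequence `[αn]β` (`n = 1, 2, …`) is uniformly distributed mod 1
  (counting form `IsUDModOne`, Håland 1994 Def. 2.1) **iff** `β ∉ span_ℚ {1, α⁻¹}`

(I. J. Håland, *Uniform distribution of generalized polynomials of the product type*, Acta Arith.
67 (1994) 13–27, p. 13: "When `k = 1`, the identity `[αn]β ≡ αβn − {αn}β (mod 1)` implies that
the sequence `[αn]β` is uniformly distributed (mod 1) if and only if `β` is rationally independent
of `1, 1/α` [4, Theorem 5.1.8]", `[4]` = Kuipers–Niederreiter 1974, Ch. 5 Thm 1.8; read in the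
held copy `paper:doi-10-4064-aa-67-1-13-27`, p. 13). It is kept in a sibling module so that the
fact file and its importers do not acquire the Fourier-analytic imports. Everything here is
proved; no named facts, no new definitions.

## The argument (the printed identity, made quantitative)

Write `e(x) = exp(2πix)`, `{·}` = fractional part, `u_n = {αn}`. The printed identity says
`e(k[αn]β) = e(αγn) · e(−γu_n)` with `γ = kβ` (`weyl_floor_mul`, a `ring` step). Then:

* (⇐, `weyl_core` + `isUDModOne_of_weyl`) If `β ∉ ℚ + ℚα⁻¹` then no frequency `α(γ + m)`,
  `m ∈ ℤ`, is an integer (`nonresonance`). The function `E(u) = e(−γu)` on `[0, 1)` is, after the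
  change of variable `x = 2πu`, modified on the last `δ`-fraction of the period into a continuous
  function `g` on `[0, 2π]` with `g(0) = g(2π)` (a linear cut-off `ρ`), which descends to the circle
  `ℝ/2πℤ` and is approximated uniformly within `ε` by a trigonometric polynomial
  `P(x) = ∑ c_m e^{imx}` (`WeylCircle.exists_trigPoly_approx`, i.e. Fejér/Weierstrass from
  Mathlib's `span_fourier_closure_eq_top`). Accordingly
  `∑_{n ≤ N} e(αγn)E(u_n) = ∑_m c_m ∑_{n ≤ N} e(α(γ+m)n) + O(εN) + 2·#{n ≤ N : u_n ≥ 1 − δ}`;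
  the geometric sums are bounded (`norm_sum_cexp_le`), and the last count is `≈ δN` by the
  equidistribution of `nα` (`isUDModOne_mul_irrational`, itself from bounded geometric sums and
  the tree's `WeylCircle.tendsto_card_arc_div`). Hence every Weyl sum of `[αn]β` is `o(N)`, and
  `WeylCircle.tendsto_card_arc_div` (Weyl's criterion, sufficiency; bridged to the `Int.fract`
  counting form in `isUDModOne_of_weyl`) gives uniform distribution.
* (⇒, `not_isUDModOne_of_mem_span`) If `β = p + q/α` (`p, q ∈ ℚ`), take a common denominator:
  `dβ = a + b/α` with `a, b ∈ ℤ`, `d ≥ 1`. The identity gives `e(d{[αn]β}) = e(c·u_n)` with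
  `c = −b/α`, which is `0` (if `b = 0`) or irrational. Along a u.d. sequence Riemann sums of
  continuous functions converge to the integral (`tendsto_avg_of_isUDModOne`, the step from
  intervals to continuous functions, by binning and uniform continuity), so if `[αn]β` were u.d.
  the averages of `e(d{[αn]β})` would tend to `∫₀¹ e(dt)dt = 0`, whereas as averages of `e(c u_n)`
  they tend to `∫₀¹ e(ct)dt ≠ 0` (`= 1` if `c = 0`, `= (e(c) − 1)/(2πic)` otherwise).

## Main statements

* `Haland1994.isUDModOne_of_weyl` — Weyl sums `o(N)` ⇒ `IsUDModOne` (Weyl 1916, sufficiency).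
* `Haland1994.isUDModOne_mul_irrational` — `nα` is u.d. mod 1 for irrational `α` (Weyl 1916).
* `Haland1994.tendsto_avg_of_isUDModOne` — u.d. ⇒ `(1/N)∑ f({x_n}) → ∫₀¹ f` for continuous `f`.
* `Haland1994.not_isUDModOne_of_mem_span`, `Haland1994.weyl_floor_mul` — the two halves.
* `Haland1994_bracketLinear_iff_holds` — the discharge.

## References

* [Haland1994] I. J. Håland, Acta Arith. 67 (1994) 13–27, §1 p. 13 (the `k = 1` remark and its
  one-line proof), Def. 2.1 p. 14. doi:10.4064/aa-67-1-13-27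
* [KuipersNiederreiter1974] L. Kuipers, H. Niederreiter, *Uniform Distribution of Sequences*,
  Wiley 1974, Ch. 1 (Thm 1.1, Thm 2.1: Weyl criterion), Ch. 5 Thm 1.8 (cited through Håland; text
  not held).
* [Weyl1916] H. Weyl, *Über die Gleichverteilung von Zahlen mod. Eins*, Math. Ann. 77 (1916),
  §1 (Satz 1–3).
-/

noncomputable section

open Filter Topology Asymptotics Finset Complex MeasureTheory

namespace Literature.NumberTheory.DiophantineApproximation

namespace Haland1994

/-! ### 1. From Weyl sums to `IsUDModOne` (Weyl's criterion, sufficiency) -/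

/-- For `0 ≤ a ≤ 1`, `b ≤ 1`: `{t − a} < b − a ↔ {t} ∈ [a, b)`. [folklore] -/
theorem fract_sub_lt_iff {a b t : ℝ} (ha : 0 ≤ a) (ha1 : a ≤ 1) (hb : b ≤ 1) :
    Int.fract (t - a) < b - a ↔ Int.fract t ∈ Set.Ico a b := by
  rcases le_or_gt a (Int.fract t) with h | h
  · have hft : Int.fract (t - a) = Int.fract t - a := by
      rw [Int.fract_eq_iff]
      refine ⟨by linarith, by linarith [Int.fract_lt_one t], ⌊t⌋, ?_⟩
      rw [← Int.self_sub_floor t]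
      ring
    rw [hft, Set.mem_Ico]
    exact ⟨fun h' => ⟨h, by linarith⟩, fun h' => by linarith [h'.2]⟩
  · have hft : Int.fract (t - a) = Int.fract t - a + 1 := by
      rw [Int.fract_eq_iff]
      refine ⟨by linarith [Int.fract_nonneg t], by linarith, ⌊t⌋ - 1, ?_⟩
      rw [← Int.self_sub_floor t]
      push_cast
      ring
    rw [hft, Set.mem_Ico]
    exact ⟨fun h' => absurd (Int.fract_nonneg t) (by linarith), fun h' => by linarith [h'.1]⟩

/-- The arc condition of `WeylCircle.tendsto_card_arc_div` at angle `2πt`, base point `2πa` and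
length `2π(b − a)` is membership of the fractional part `{t}` in `[a, b)`. [folklore] -/
theorem toIcoMod_lt_iff {a b : ℝ} (ha : 0 ≤ a) (ha1 : a ≤ 1) (hb : b ≤ 1) (t : ℝ) :
    toIcoMod Real.two_pi_pos (2 * Real.pi * a) (2 * Real.pi * t) <
        2 * Real.pi * a + 2 * Real.pi * (b - a) ↔ Int.fract t ∈ Set.Ico a b := by
  have hπ := Real.pi_pos
  rw [toIcoMod_eq_add_fract_mul, ← fract_sub_lt_iff ha ha1 hb]
  have h1 : (2 * Real.pi * t - 2 * Real.pi * a) / (2 * Real.pi) = t - a := by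
    field_simp
  rw [h1, add_lt_add_iff_left, mul_comm]
  exact mul_lt_mul_iff_right₀ (by positivity)

/-- **Weyl's criterion (sufficiency) in the counting form of `IsUDModOne`.** If for every integer
`k ≠ 0` the Weyl sums `∑_{n=1}^{N} e^{2πi k x_n}` are `o(N)`, then `x` is uniformly distributed
mod 1 in the printed sense (Håland 1994, Def. 2.1). From `WeylCircle.tendsto_card_arc_div`.
[cite: Weyl1916, §1] -/
theorem isUDModOne_of_weyl (x : ℕ → ℝ)
    (hW : ∀ k : ℤ, k ≠ 0 →
      (fun N : ℕ ↦ ∑ n ∈ Icc 1 N, cexp (2 * Real.pi * I * k * x n)) =o[atTop]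
        fun N ↦ (N : ℝ)) :
    IsUDModOne x := by
  intro a b ha hab hb1
  have hcard : ∀ N, (Icc 1 N).card = N := fun N ↦ by simp
  have h0 : Tendsto (fun N ↦ (Icc 1 N).card) atTop atTop := by
    simp_rw [hcard]; exact tendsto_id
  -- the Weyl sums in the syntactic form of `WeylCircle.tendsto_card_arc_div`
  set ω : ℕ → ℝ := fun n ↦ 2 * Real.pi * x n with hω
  have hW' : ∀ k : ℤ, k ≠ 0 → (fun N ↦ ∑ n ∈ Icc 1 N, cexp (k * ω n * I))
      =o[atTop] fun N ↦ (((Icc 1 N).card : ℕ) : ℝ) := by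
    intro k hk
    refine (hW k hk).congr' (Eventually.of_forall fun N ↦ ?_) (Eventually.of_forall fun N ↦ ?_)
    · refine Finset.sum_congr rfl fun n _ ↦ ?_
      rw [hω]
      push_cast
      ring_nf
    · simp only [hcard]
  have hπ := Real.pi_pos
  have hα1 : 0 < 2 * Real.pi * (b - a) := mul_pos (by positivity) (by linarith)
  have hα2 : 2 * Real.pi * (b - a) ≤ 2 * Real.pi :=
    mul_le_of_le_one_right (by positivity) (by linarith)
  have h := WeylCircle.tendsto_card_arc_div (fun N ↦ Icc 1 N) ω h0 hW' (2 * Real.pi * a) hα1 hα2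
  have hlim : 2 * Real.pi * (b - a) / (2 * Real.pi) = b - a :=
    mul_div_cancel_left₀ _ (by positivity)
  rw [hlim] at h
  have hfun : (fun N ↦ (((Icc 1 N).filter fun n ↦ toIcoMod Real.two_pi_pos (2 * Real.pi * a)
      (ω n) < 2 * Real.pi * a + 2 * Real.pi * (b - a)).card : ℝ) /
      ((Icc 1 N).card : ℕ)) =
      fun N ↦ (((Icc 1 N).filter fun n ↦ Int.fract (x n) ∈ Set.Ico a b).card : ℝ) / N := by
    funext N
    rw [hcard, Finset.filter_congr (fun n _ ↦ toIcoMod_lt_iff ha (by linarith) hb1 (x n))]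
  rw [hfun] at h
  exact h

/-! ### 2. Geometric sums `∑_{n=1}^{N} e^{2πi n θ}` -/

/-- `(z − 1) ∑_{n=1}^{N} zⁿ = z^{N+1} − z`. [folklore] -/
theorem sub_one_mul_sum_pow (z : ℂ) (N : ℕ) :
    (z - 1) * ∑ n ∈ Icc 1 N, z ^ n = z ^ (N + 1) - z := by
  induction N with
  | zero => simp
  | succ N ih =>
    rw [Finset.sum_Icc_succ_top (by omega), mul_add, ih]
    ring

/-- `‖∑_{n=1}^{N} zⁿ‖ ≤ 2/‖z − 1‖` for `‖z‖ ≤ 1`, `z ≠ 1`. [folklore] -/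
theorem norm_sum_pow_le {z : ℂ} (hz1 : ‖z‖ ≤ 1) (hz : z ≠ 1) (N : ℕ) :
    ‖∑ n ∈ Icc 1 N, z ^ n‖ ≤ 2 / ‖z - 1‖ := by
  have hne : z - 1 ≠ 0 := sub_ne_zero.mpr hz
  have hpos : 0 < ‖z - 1‖ := norm_pos_iff.mpr hne
  rw [le_div_iff₀ hpos]
  calc ‖∑ n ∈ Icc 1 N, z ^ n‖ * ‖z - 1‖ = ‖(z - 1) * ∑ n ∈ Icc 1 N, z ^ n‖ := by
        rw [norm_mul, mul_comm]
    _ = ‖z ^ (N + 1) - z‖ := by rw [sub_one_mul_sum_pow]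
    _ ≤ ‖z ^ (N + 1)‖ + ‖z‖ := norm_sub_le _ _
    _ ≤ 1 + 1 := add_le_add (by rw [norm_pow]; exact pow_le_one₀ (norm_nonneg _) hz1) hz1
    _ = 2 := by norm_num

/-- `e^{2πiθ} ≠ 1` when `θ` is not an integer. [folklore] -/
theorem cexp_ne_one {θ : ℝ} (hθ : ∀ m : ℤ, θ ≠ m) : cexp (2 * Real.pi * I * θ) ≠ 1 := by
  intro h
  rw [Complex.exp_eq_one_iff] at h
  obtain ⟨m, hm⟩ := h
  have hI : (2 * Real.pi * I : ℂ) ≠ 0 := by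
    simp [Real.pi_ne_zero, Complex.I_ne_zero]
  have : (θ : ℂ) = m := by
    have h2 : (2 * Real.pi * I : ℂ) * θ = (2 * Real.pi * I) * m := by rw [hm]; ring
    exact mul_left_cancel₀ hI h2
  exact hθ m (by exact_mod_cast this)

/-- **Bounded Weyl sums of a linear sequence**: for `θ ∉ ℤ`,
`‖∑_{n=1}^{N} e^{2πi n θ}‖ ≤ 2/‖e^{2πiθ} − 1‖`. [folklore] -/
theorem norm_sum_cexp_le {θ : ℝ} (hθ : ∀ m : ℤ, θ ≠ m) (N : ℕ) :
    ‖∑ n ∈ Icc 1 N, cexp (2 * Real.pi * I * θ * n)‖ ≤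
      2 / ‖cexp (2 * Real.pi * I * θ) - 1‖ := by
  have h1 : ∀ n : ℕ, cexp (2 * Real.pi * I * θ * n) = cexp (2 * Real.pi * I * θ) ^ n := by
    intro n
    rw [← Complex.exp_nat_mul]
    ring_nf
  simp_rw [h1]
  refine norm_sum_pow_le (le_of_eq ?_) (cexp_ne_one hθ) N
  rw [show (2 * Real.pi * I * θ : ℂ) = (2 * Real.pi * θ : ℝ) * I by push_cast; ring]
  exact Complex.norm_exp_ofReal_mul_I _

/-- Hence `∑_{n=1}^{N} e^{2πi n θ} = o(N)` for `θ ∉ ℤ`. [folklore] -/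
theorem isLittleO_sum_cexp {θ : ℝ} (hθ : ∀ m : ℤ, θ ≠ m) :
    (fun N : ℕ ↦ ∑ n ∈ Icc 1 N, cexp (2 * Real.pi * I * θ * n)) =o[atTop] fun N ↦ (N : ℝ) := by
  set B : ℝ := 2 / ‖cexp (2 * Real.pi * I * θ) - 1‖
  have hO : (fun N : ℕ ↦ ∑ n ∈ Icc 1 N, cexp (2 * Real.pi * I * θ * n)) =O[atTop]
      fun _ ↦ (1 : ℝ) :=
    IsBigO.of_bound B (Eventually.of_forall fun N ↦ by
      rw [norm_one, mul_one]; exact norm_sum_cexp_le hθ N)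
  refine hO.trans_isLittleO ?_
  rw [Asymptotics.isLittleO_const_left]
  right
  have : (norm ∘ fun N : ℕ ↦ (N : ℝ)) = fun N : ℕ ↦ (N : ℝ) := funext fun N ↦ by simp
  rw [this]
  exact tendsto_natCast_atTop_atTop

/-! ### 3. Equidistribution of `nα` for irrational `α` -/

/-- **Weyl's equidistribution theorem for `nα`** (`α` irrational), in the counting form
`IsUDModOne`. [cite: Weyl1916, §1] -/
theorem isUDModOne_mul_irrational {α : ℝ} (hα : Irrational α) :
    IsUDModOne fun n : ℕ ↦ α * n := by
  refine isUDModOne_of_weyl _ fun k hk ↦ ?_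
  have hθ : ∀ m : ℤ, (k : ℝ) * α ≠ m := fun m h ↦
    (hα.intCast_mul hk).ne_int m h
  have h := isLittleO_sum_cexp hθ
  refine h.congr' (Eventually.of_forall fun N ↦ ?_) EventuallyEq.rfl
  refine Finset.sum_congr rfl fun n _ ↦ ?_
  congr 1
  push_cast
  ring


/-! ### 4. A uniformly distributed sequence integrates continuous functions -/

/-- The bin index `⌊K u⌋₊` of `u ∈ [0, 1)` equals `j` iff `u ∈ [j/K, (j+1)/K)`. [folklore] -/
theorem floor_mul_eq_iff {K : ℕ} (hK : (0 : ℝ) < K) {u : ℝ} (hu : 0 ≤ u) (j : ℕ) :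
    ⌊(K : ℝ) * u⌋₊ = j ↔ u ∈ Set.Ico ((j : ℝ) / K) ((j + 1 : ℝ) / K) := by
  rw [Nat.floor_eq_iff (by positivity), Set.mem_Ico, div_le_iff₀ hK, lt_div_iff₀ hK, mul_comm u]

/-- **Riemann sums along a uniformly distributed sequence.** If `x` is uniformly distributed
mod 1 (counting form, Håland 1994 Def. 2.1) and `f` is continuous on `[0, 1]`, then
`(1/N) ∑_{n=1}^{N} f({x_n}) → ∫₀¹ f`. (Kuipers–Niederreiter Ch. 1, Thm 1.1 / Cor. 1.1: the step
from intervals to continuous functions; proved here by binning into `K` equal cells and uniform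
continuity.) [folklore] -/
theorem tendsto_avg_of_isUDModOne {x : ℕ → ℝ} (hx : IsUDModOne x) {f : ℝ → ℂ}
    (hf : ContinuousOn f (Set.Icc 0 1)) :
    Tendsto (fun N : ℕ ↦ (∑ n ∈ Icc 1 N, f (Int.fract (x n))) / N) atTop
      (𝓝 (∫ t in (0 : ℝ)..1, f t)) := by
  rw [Metric.tendsto_atTop]
  intro ε hε
  have hη : 0 < ε / 3 := by positivity
  -- uniform continuity of `f` on `[0, 1]`
  obtain ⟨δ, hδ, hUC⟩ := Metric.uniformContinuousOn_iff_le.1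
    (isCompact_Icc.uniformContinuousOn_of_continuous hf) (ε / 3) hη
  -- number of bins
  obtain ⟨K, hK⟩ := exists_nat_gt (1 / δ)
  have hKr : (0 : ℝ) < K := lt_trans (by positivity) hK
  have hK0 : 0 < K := by exact_mod_cast hKr
  have hKδ : 1 / (K : ℝ) ≤ δ := by
    rw [div_le_iff₀ hKr]
    rw [div_lt_iff₀ hδ] at hK
    linarith
  -- the bin index of `x n`
  set g : ℕ → ℕ := fun n ↦ ⌊(K : ℝ) * Int.fract (x n)⌋₊ with hg
  have hg_lt : ∀ n, g n < K := fun n ↦ by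
    simp only [hg]
    rw [Nat.floor_lt (by positivity [Int.fract_nonneg (x n)])]
    exact mul_lt_of_lt_one_right hKr (Int.fract_lt_one _)
  have hg_mem : ∀ n, Int.fract (x n) ∈ Set.Ico ((g n : ℝ) / K) ((g n + 1 : ℝ) / K) := fun n ↦
    (floor_mul_eq_iff hKr (Int.fract_nonneg _) (g n)).1 rfl
  -- pointwise: `f({x n})` is within `ε/3` of `f(g n / K)`
  have hpt : ∀ n, ‖f (Int.fract (x n)) - f ((g n : ℝ) / K)‖ ≤ ε / 3 := by
    intro n
    obtain ⟨h1, h2⟩ := hg_mem n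
    have hu1 : Int.fract (x n) < 1 := Int.fract_lt_one _
    have hgK : ((g n : ℝ) + 1) / K ≤ 1 := by
      rw [div_le_one hKr]; exact_mod_cast hg_lt n
    rw [← dist_eq_norm]
    refine hUC _ ⟨Int.fract_nonneg _, hu1.le⟩ _ ⟨by positivity, by linarith⟩ ?_
    rw [Real.dist_eq, abs_of_nonneg (by linarith)]
    have : ((g n : ℝ) + 1) / K = (g n : ℝ) / K + 1 / K := by ring
    linarith
  -- the binned sums, fibrewise
  have hbin : ∀ N, ∑ n ∈ Icc 1 N, f ((g n : ℝ) / K) =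
      ∑ j ∈ range K, (((Icc 1 N).filter fun n ↦ g n = j).card : ℂ) * f ((j : ℝ) / K) := by
    intro N
    rw [← Finset.sum_fiberwise_of_maps_to' (g := g) (t := range K)
      (fun n _ ↦ mem_range.mpr (hg_lt n)) (fun j : ℕ ↦ f ((j : ℝ) / K))]
    refine Finset.sum_congr rfl fun j _ ↦ ?_
    rw [Finset.sum_const, nsmul_eq_mul]
  -- each bin has asymptotic frequency `1/K`
  have hfreq : ∀ j ∈ range K, Tendsto (fun N : ℕ ↦
      ((((Icc 1 N).filter fun n ↦ g n = j).card : ℂ)) / N * f ((j : ℝ) / K)) atTop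
      (𝓝 ((1 / K : ℂ) * f ((j : ℝ) / K))) := by
    intro j hj
    rw [mem_range] at hj
    have hj1 : ((j : ℝ) + 1) / K ≤ 1 := by rw [div_le_one hKr]; exact_mod_cast hj
    have h := hx ((j : ℝ) / K) (((j : ℝ) + 1) / K) (by positivity)
      (div_lt_div_of_pos_right (by linarith) hKr) hj1
    have heq : ∀ N, ((Icc 1 N).filter fun n ↦ Int.fract (x n) ∈ Set.Ico ((j : ℝ) / K)
        (((j : ℝ) + 1) / K)) = (Icc 1 N).filter fun n ↦ g n = j := fun N ↦
      Finset.filter_congr fun n _ ↦ (floor_mul_eq_iff hKr (Int.fract_nonneg _) j).symm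
    simp_rw [heq, show ((j : ℝ) + 1) / K - j / K = 1 / K by ring] at h
    have h' : Tendsto (fun N : ℕ ↦ (((((Icc 1 N).filter fun n ↦ g n = j).card : ℝ) / N : ℝ) : ℂ) *
        f ((j : ℝ) / K)) atTop (𝓝 ((((1 / K : ℝ)) : ℂ) * f ((j : ℝ) / K))) :=
      ((Complex.continuous_ofReal.tendsto _).comp h).mul_const _
    simp only [Complex.ofReal_div, Complex.ofReal_natCast, Complex.ofReal_one] at h'
    exact h'
  have hlimK : Tendsto (fun N : ℕ ↦ (∑ n ∈ Icc 1 N, f ((g n : ℝ) / K)) / N) atTop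
      (𝓝 (∑ j ∈ range K, (1 / K : ℂ) * f ((j : ℝ) / K))) := by
    have := tendsto_finsetSum (range K) hfreq
    refine this.congr fun N ↦ ?_
    rw [hbin, Finset.sum_div]
    refine Finset.sum_congr rfl fun j _ ↦ ?_
    ring
  -- the Riemann sum is within `ε/3` of the integral
  have hint : ∀ j < K, IntervalIntegrable f volume ((j : ℝ) / K) (((j + 1 : ℕ) : ℝ) / K) := by
    intro j hj
    refine (hf.mono ?_).intervalIntegrable
    have hle : (j : ℝ) / K ≤ ((j + 1 : ℕ) : ℝ) / K :=
      div_le_div_of_nonneg_right (by push_cast; linarith) hKr.le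
    rw [Set.uIcc_of_le hle]
    refine Set.Icc_subset_Icc (by positivity) ?_
    rw [div_le_one hKr]; exact_mod_cast hj
  have hRiemann : ‖(∑ j ∈ range K, (1 / K : ℂ) * f ((j : ℝ) / K)) - ∫ t in (0 : ℝ)..1, f t‖ ≤
      ε / 3 := by
    have hsplit := intervalIntegral.sum_integral_adjacent_intervals hint
    simp only [Nat.cast_zero, zero_div, div_self hKr.ne'] at hsplit
    rw [← hsplit, ← Finset.sum_sub_distrib]
    have hterm : ∀ j ∈ range K, ‖(1 / K : ℂ) * f ((j : ℝ) / K) -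
        ∫ t in ((j : ℝ) / K)..(((j + 1 : ℕ) : ℝ) / K), f t‖ ≤ ε / 3 * (1 / K) := by
      intro j hj
      rw [mem_range] at hj
      have hle : (j : ℝ) / K ≤ ((j + 1 : ℕ) : ℝ) / K :=
        div_le_div_of_nonneg_right (by push_cast; linarith) hKr.le
      have hj1 : (((j + 1 : ℕ) : ℝ)) / K ≤ 1 := by rw [div_le_one hKr]; exact_mod_cast hj
      have hlen : (((j + 1 : ℕ) : ℝ)) / K - (j : ℝ) / K = 1 / K := by push_cast; ring
      have hconst : (1 / K : ℂ) * f ((j : ℝ) / K) =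
          ∫ _ in ((j : ℝ) / K)..(((j + 1 : ℕ) : ℝ) / K), f ((j : ℝ) / K) := by
        rw [intervalIntegral.integral_const, hlen, Complex.real_smul]
        push_cast
        ring
      rw [hconst, ← intervalIntegral.integral_sub intervalIntegrable_const (hint j hj)]
      have hb := intervalIntegral.norm_integral_le_of_norm_le_const (a := (j : ℝ) / K)
        (b := ((j + 1 : ℕ) : ℝ) / K) (C := ε / 3) (f := fun t ↦ f ((j : ℝ) / K) - f t) ?_
      · rw [hlen, abs_of_pos (by positivity)] at hb
        exact hb
      · intro t ht
        rw [Set.uIoc_of_le hle, Set.mem_Ioc] at ht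
        rw [← dist_eq_norm]
        refine hUC _ ⟨by positivity, le_trans (le_of_lt ht.1) (ht.2.trans hj1)⟩ _
          ⟨le_trans (by positivity) ht.1.le, ht.2.trans hj1⟩ ?_
        rw [Real.dist_eq, abs_of_nonpos (by linarith)]
        linarith
    calc ‖∑ j ∈ range K, ((1 / K : ℂ) * f ((j : ℝ) / K) -
          ∫ t in ((j : ℝ) / K)..(((j + 1 : ℕ) : ℝ) / K), f t)‖
        ≤ ∑ j ∈ range K, ‖(1 / K : ℂ) * f ((j : ℝ) / K) -
          ∫ t in ((j : ℝ) / K)..(((j + 1 : ℕ) : ℝ) / K), f t‖ := norm_sum_le _ _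
      _ ≤ ∑ j ∈ range K, ε / 3 * (1 / K) := Finset.sum_le_sum hterm
      _ = ε / 3 := by
        rw [Finset.sum_const, Finset.card_range, nsmul_eq_mul]
        field_simp
  -- assemble
  rw [Metric.tendsto_atTop] at hlimK
  obtain ⟨N₁, hN₁⟩ := hlimK (ε / 3) hη
  refine ⟨max 1 N₁, fun N hN ↦ ?_⟩
  have hN1 : 1 ≤ N := le_trans (le_max_left _ _) hN
  have hNr : (0 : ℝ) < N := by exact_mod_cast hN1
  have hA : dist ((∑ n ∈ Icc 1 N, f (Int.fract (x n))) / N)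
      ((∑ n ∈ Icc 1 N, f ((g n : ℝ) / K)) / N) ≤ ε / 3 := by
    rw [dist_eq_norm, ← sub_div, ← Finset.sum_sub_distrib, norm_div, Complex.norm_natCast,
      div_le_iff₀ hNr]
    calc ‖∑ n ∈ Icc 1 N, (f (Int.fract (x n)) - f ((g n : ℝ) / K))‖
        ≤ ∑ n ∈ Icc 1 N, ‖f (Int.fract (x n)) - f ((g n : ℝ) / K)‖ := norm_sum_le _ _
      _ ≤ ∑ n ∈ Icc 1 N, ε / 3 := Finset.sum_le_sum fun n _ ↦ hpt n
      _ = ε / 3 * N := by rw [Finset.sum_const, Nat.card_Icc, nsmul_eq_mul]; push_cast; ring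
  have hB := hN₁ N (le_trans (le_max_right _ _) hN)
  have hC : dist (∑ j ∈ range K, (1 / K : ℂ) * f ((j : ℝ) / K)) (∫ t in (0 : ℝ)..1, f t) ≤
      ε / 3 := by rw [dist_eq_norm]; exact hRiemann
  calc dist ((∑ n ∈ Icc 1 N, f (Int.fract (x n))) / N) (∫ t in (0 : ℝ)..1, f t)
      ≤ dist ((∑ n ∈ Icc 1 N, f (Int.fract (x n))) / N)
          ((∑ n ∈ Icc 1 N, f ((g n : ℝ) / K)) / N) +
        (dist ((∑ n ∈ Icc 1 N, f ((g n : ℝ) / K)) / N)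
          (∑ j ∈ range K, (1 / K : ℂ) * f ((j : ℝ) / K)) +
        dist (∑ j ∈ range K, (1 / K : ℂ) * f ((j : ℝ) / K)) (∫ t in (0 : ℝ)..1, f t)) :=
        dist_triangle4 _ _ _ _ |>.trans (by rw [add_assoc])
    _ < ε / 3 + (ε / 3 + ε / 3) := by linarith [hA, hB, hC]
    _ = ε := by ring

/-! ### 5. Necessity: for `β ∈ ℚ + ℚ·α⁻¹` the sequence `[αn]β` is not u.d. mod 1 -/

/-- `∫₀¹ e^{2πi d t} dt = 0` for a non-zero natural number `d`. [folklore] -/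
theorem integral_cexp_nat {d : ℕ} (hd : d ≠ 0) :
    ∫ t in (0 : ℝ)..1, cexp (2 * Real.pi * I * d * t) = 0 := by
  have hc : (2 * Real.pi * I * d : ℂ) ≠ 0 := by
    have : (d : ℂ) ≠ 0 := by exact_mod_cast hd
    simp [Real.pi_ne_zero, Complex.I_ne_zero, this]
  rw [integral_exp_mul_complex hc]
  simp only [Complex.ofReal_one, Complex.ofReal_zero, mul_one, mul_zero, Complex.exp_zero]
  rw [show (2 * Real.pi * I * d : ℂ) = d * (2 * Real.pi * I) by ring,
    Complex.exp_nat_mul_two_pi_mul_I, sub_self, zero_div]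

/-- `∫₀¹ e^{2πi c t} dt ≠ 0` when `c` is not an integer. [folklore] -/
theorem integral_cexp_ne_zero {c : ℝ} (hc : ∀ m : ℤ, c ≠ m) :
    ∫ t in (0 : ℝ)..1, cexp (2 * Real.pi * I * c * t) ≠ 0 := by
  have hc0 : c ≠ 0 := fun h ↦ hc 0 (by simp [h])
  have hC : (2 * Real.pi * I * c : ℂ) ≠ 0 := by
    have : (c : ℂ) ≠ 0 := by exact_mod_cast hc0
    simp [Real.pi_ne_zero, Complex.I_ne_zero, this]
  rw [integral_exp_mul_complex hC]
  simp only [Complex.ofReal_one, Complex.ofReal_zero, mul_one, mul_zero, Complex.exp_zero]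
  exact div_ne_zero (sub_ne_zero.mpr (cexp_ne_one hc)) hC

/-- `∫₀¹ e^{2πi c t} dt ≠ 0` when `c = 0` or `c ∉ ℤ`. [folklore] -/
theorem integral_cexp_ne_zero' {c : ℝ} (hc : c = 0 ∨ ∀ m : ℤ, c ≠ m) :
    ∫ t in (0 : ℝ)..1, cexp (2 * Real.pi * I * c * t) ≠ 0 := by
  rcases hc with rfl | hc
  · simp
  · exact integral_cexp_ne_zero hc

/-- A common denominator for two rationals: `d p = a`, `d q = b` with `d ≥ 1` and `a, b ∈ ℤ`.
[folklore] -/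
theorem exists_common_den (p q : ℚ) :
    ∃ (d : ℕ) (a b : ℤ), 0 < d ∧ (d : ℝ) * p = a ∧ (d : ℝ) * q = b := by
  refine ⟨p.den * q.den, p.num * q.den, q.num * p.den, Nat.mul_pos p.den_pos q.den_pos, ?_, ?_⟩
  · have hp' : ((p.den : ℝ)) * (p : ℝ) = p.num := by exact_mod_cast Rat.den_mul_eq_num p
    push_cast
    linear_combination (q.den : ℝ) * hp'
  · have hq' : ((q.den : ℝ)) * (q : ℝ) = q.num := by exact_mod_cast Rat.den_mul_eq_num q
    push_cast
    linear_combination (p.den : ℝ) * hq'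

/-- **Necessity half of the `k = 1` criterion.** If `α` is irrational and `β = p + q/α` with
`p, q ∈ ℚ`, then `[αn]β` is NOT uniformly distributed mod 1: with `d` a common denominator,
`dβ = a + b/α` (`a, b ∈ ℤ`), the printed identity `[αn]β ≡ αβn − {αn}β` gives
`e(d{[αn]β}) = e(c{αn})` with `c = −b/α ∈ {0} ∪ (ℝ ∖ ℚ)`; along a u.d. sequence the left side
averages to `∫₀¹ e(dt)dt = 0`, while by the equidistribution of `nα` the right side averages to
`∫₀¹ e(ct)dt ≠ 0`. [cite: Haland1994, §1 p. 13] -/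
theorem not_isUDModOne_of_mem_span {α β : ℝ} (hα : Irrational α)
    (hβ : β ∈ Submodule.span ℚ ({1, α⁻¹} : Set ℝ)) :
    ¬ IsUDModOne (fun n : ℕ ↦ (⌊α * n⌋ : ℝ) * β) := by
  intro hud
  obtain ⟨p, q, hpq⟩ := Submodule.mem_span_pair.1 hβ
  simp only [Rat.smul_def, mul_one] at hpq
  obtain ⟨d, a, b, hd0, hdp, hdq⟩ := exists_common_den p q
  have hα0 : α ≠ 0 := hα.ne_zero
  have hdβ : (d : ℝ) * β = a + b * α⁻¹ := by
    rw [← hpq, mul_add, ← mul_assoc, hdp, hdq]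
  set c : ℝ := -(b : ℝ) * α⁻¹ with hc
  -- the printed identity, exponentiated: `e(d{[αn]β}) = e(c{αn})`
  have hkey : ∀ n : ℕ, cexp (2 * Real.pi * I * d * Int.fract ((⌊α * n⌋ : ℝ) * β)) =
      cexp (2 * Real.pi * I * c * Int.fract (α * n)) := by
    intro n
    have e2 : α * α⁻¹ = 1 := mul_inv_cancel₀ hα0
    have h1 : (d : ℝ) * Int.fract ((⌊α * n⌋ : ℝ) * β) =
        ((a * ⌊α * n⌋ + b * n - d * ⌊(⌊α * n⌋ : ℝ) * β⌋ : ℤ) : ℝ) + c * Int.fract (α * n) := by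
      rw [← Int.self_sub_floor, ← Int.self_sub_floor, hc]
      push_cast
      linear_combination (⌊α * n⌋ : ℝ) * hdβ + (b : ℝ) * (n : ℝ) * e2
    have h2 : (2 * Real.pi * I * d * Int.fract ((⌊α * n⌋ : ℝ) * β) : ℂ) =
        ((a * ⌊α * n⌋ + b * n - d * ⌊(⌊α * n⌋ : ℝ) * β⌋ : ℤ) : ℂ) * (2 * Real.pi * I) +
          2 * Real.pi * I * c * Int.fract (α * n) := by
      have h1' := congrArg (fun r : ℝ ↦ (r : ℂ)) h1
      simp only [Complex.ofReal_mul, Complex.ofReal_add, Complex.ofReal_natCast,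
        Complex.ofReal_intCast] at h1'
      linear_combination (2 * Real.pi * I) * h1'
    rw [h2, Complex.exp_add, Complex.exp_int_mul_two_pi_mul_I, one_mul]
  -- averages along the u.d. sequence `[αn]β`: limit `∫₀¹ e(dt) dt = 0`
  have hT1 := tendsto_avg_of_isUDModOne hud (f := fun u : ℝ ↦ cexp (2 * Real.pi * I * d * u))
    (by fun_prop)
  rw [integral_cexp_nat hd0.ne'] at hT1
  have hT1' : Tendsto (fun N : ℕ ↦ (∑ n ∈ Icc 1 N,
      cexp (2 * Real.pi * I * c * Int.fract (α * n))) / N) atTop (𝓝 0) :=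
    hT1.congr fun N ↦ by simp only [hkey]
  -- the same averages, via the equidistribution of `nα`: limit `∫₀¹ e(ct) dt`
  have hT2 : Tendsto (fun N : ℕ ↦ (∑ n ∈ Icc 1 N,
      cexp (2 * Real.pi * I * c * Int.fract (α * n))) / N) atTop
      (𝓝 (∫ t in (0 : ℝ)..1, cexp (2 * Real.pi * I * c * t))) :=
    tendsto_avg_of_isUDModOne (isUDModOne_mul_irrational hα)
      (f := fun u : ℝ ↦ cexp (2 * Real.pi * I * c * u)) (by fun_prop)
  have hJ := tendsto_nhds_unique hT2 hT1'
  refine integral_cexp_ne_zero' ?_ hJ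
  by_cases hb : b = 0
  · left
    rw [hc, hb]
    simp
  · right
    intro m hm
    have hirr : Irrational c := by
      rw [hc, neg_mul]
      exact (hα.inv.intCast_mul hb).neg
    exact hirr.ne_int m hm

/-! ### 6. Sufficiency: the Weyl sums of `[αn]β` for `β ∉ ℚ + ℚ·α⁻¹` -/

/-- **Non-resonance.** If `β ∉ span_ℚ {1, α⁻¹}` (`α ≠ 0`) and `k ≠ 0`, then no frequency
`α(kβ + m)`, `m ∈ ℤ`, is an integer. [cite: Haland1994, §1 p. 13] -/
theorem nonresonance {α β : ℝ} (hα0 : α ≠ 0) (hβ : β ∉ Submodule.span ℚ ({1, α⁻¹} : Set ℝ))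
    {k : ℤ} (hk : k ≠ 0) (m z : ℤ) : α * (k * β + m) ≠ z := by
  intro h
  apply hβ
  rw [Submodule.mem_span_pair]
  refine ⟨(-m / k : ℚ), (z / k : ℚ), ?_⟩
  simp only [Rat.smul_def, mul_one]
  have hk' : (k : ℝ) ≠ 0 := by exact_mod_cast hk
  have h1 : (k : ℝ) * β + m = α⁻¹ * z := by
    rw [← h, ← mul_assoc, inv_mul_cancel₀ hα0, one_mul]
  have h2 : β = (α⁻¹ * z - m) / k := by
    rw [eq_div_iff hk']
    linarith [h1]
  rw [h2]
  push_cast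
  ring

/-- `2πr ≡ 2π{r}` on the circle `ℝ/2πℤ`. [folklore] -/
theorem coe_two_pi_mul_eq (r : ℝ) :
    ((2 * Real.pi * r : ℝ) : AddCircle (2 * Real.pi)) =
      ((2 * Real.pi * Int.fract r : ℝ) : AddCircle (2 * Real.pi)) := by
  rw [eq_comm, ← sub_eq_zero, ← AddCircle.coe_sub, AddCircle.coe_eq_zero_iff]
  refine ⟨-⌊r⌋, ?_⟩
  rw [zsmul_eq_mul, ← Int.self_sub_floor]
  push_cast
  ring

/-- **The core estimate** (sufficiency half of the `k = 1` criterion, after the printed identity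
`[αn]β ≡ αβn − {αn}β`). For irrational `α` and a real `γ` with `α(γ + m) ∉ ℤ` for all `m ∈ ℤ`,
`∑_{n=1}^{N} e(αγ n) e(−γ{αn}) = o(N)`: approximate the `2π`-periodic continuous modification
`G` of `t ↦ e^{−iγt}` (cut off on the last `δ`-fraction of the period) uniformly by a
trigonometric polynomial (`WeylCircle.exists_trigPoly_approx`); the main term is a finite
combination of bounded geometric sums at the non-integral frequencies `α(γ + m)`, the
approximation error is `≤ εN`, and the cut-off region is visited `≈ δN` times by the
equidistribution of `nα`. [cite: Haland1994, §1 p. 13] -/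
theorem weyl_core {α γ : ℝ} (hα : Irrational α) (hres : ∀ m z : ℤ, α * (γ + m) ≠ z) :
    (fun N : ℕ ↦ ∑ n ∈ Icc 1 N, cexp (2 * Real.pi * I * ((α * γ : ℝ) : ℂ) * n) *
        cexp (-(γ * (2 * Real.pi * Int.fract (α * n))) * I)) =o[atTop] fun N ↦ (N : ℝ) := by
  have hπ := Real.pi_pos
  rw [Asymptotics.isLittleO_iff]
  intro ε' hε'
  -- parameters
  set δ : ℝ := min (1 / 2) (ε' / 8) with hδdef
  have hδ : 0 < δ := lt_min (by norm_num) (by positivity)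
  have hδ1 : δ ≤ 1 / 2 := min_le_left _ _
  have hδε : δ ≤ ε' / 8 := min_le_right _ _
  have hε4 : 0 < ε' / 4 := by positivity
  -- the cut-off `ρ(x) = max(0, (x − 2π(1−δ))/(2πδ))` and the modification
  -- `g(x) = e^{-iγx}(1 − ρ(x)) + ρ(x)` of `e^{-iγx}`: continuous, `g(0) = g(2π) = 1`
  set ρ : ℝ → ℝ := fun x ↦ max 0 ((x - 2 * Real.pi * (1 - δ)) / (2 * Real.pi * δ)) with hρ
  have hρc : Continuous ρ :=
    continuous_const.max ((continuous_id.sub continuous_const).div_const _)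
  have hρ0 : ∀ x, x ≤ 2 * Real.pi * (1 - δ) → ρ x = 0 := fun x hx ↦ by
    rw [hρ]
    exact max_eq_left (div_nonpos_of_nonpos_of_nonneg (by linarith) (by positivity))
  have hρ1 : ρ (2 * Real.pi) = 1 := by
    rw [hρ]
    simp only
    rw [show (2 * Real.pi - 2 * Real.pi * (1 - δ)) = 2 * Real.pi * δ by ring,
      div_self (by positivity)]
    simp
  have hρI : ∀ x, x ≤ 2 * Real.pi → ρ x ∈ Set.Icc (0 : ℝ) 1 := fun x hx ↦ by
    rw [hρ]
    refine ⟨le_max_left _ _, max_le zero_le_one ?_⟩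
    rw [div_le_one (by positivity)]
    linarith
  set g : ℝ → ℂ := fun x ↦ cexp (-(γ * x) * I) * ((1 - ρ x : ℝ) : ℂ) + (ρ x : ℂ) with hg
  have hgc : Continuous g := by
    rw [hg]
    fun_prop
  have hg_eq : ∀ x, x ≤ 2 * Real.pi * (1 - δ) → g x = cexp (-(γ * x) * I) := fun x hx ↦ by
    rw [hg]
    simp only
    rw [hρ0 x hx]
    simp
  have hg0 : g 0 = g (2 * Real.pi) := by
    rw [hg_eq 0 (by nlinarith), hg]
    simp only
    rw [hρ1]
    simp
  have hg_norm : ∀ x, x ≤ 2 * Real.pi → ‖g x‖ ≤ 1 := fun x hx ↦ by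
    obtain ⟨h0, h1⟩ := hρI x hx
    rw [hg]
    simp only
    have hE : ‖cexp (-(γ * x) * I)‖ = 1 := by
      rw [show (-(γ * x) * I : ℂ) = ((-(γ * x) : ℝ)) * I by push_cast; ring]
      exact Complex.norm_exp_ofReal_mul_I _
    calc ‖cexp (-(γ * x) * I) * ((1 - ρ x : ℝ) : ℂ) + (ρ x : ℂ)‖
        ≤ ‖cexp (-(γ * x) * I) * ((1 - ρ x : ℝ) : ℂ)‖ + ‖(ρ x : ℂ)‖ := norm_add_le _ _
      _ = (1 - ρ x) + ρ x := by
          rw [norm_mul, hE, one_mul, Complex.norm_real, Complex.norm_real, Real.norm_eq_abs,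
            Real.norm_eq_abs, abs_of_nonneg (by linarith), abs_of_nonneg h0]
      _ = 1 := by ring
  -- `g` descends to a continuous function `G` on `ℝ/2πℤ`; approximate it by a trigonometric
  -- polynomial `P = ∑ c_m e^{imx}` within `ε'/4`
  have hfact : Fact (0 < 2 * Real.pi) := ⟨Real.two_pi_pos⟩
  obtain ⟨G, hG⟩ : ∃ G : C(AddCircle (2 * Real.pi), ℂ), ∀ x ∈ Set.Ico 0 (2 * Real.pi),
      G ((x : ℝ) : AddCircle (2 * Real.pi)) = g x :=
    ⟨⟨AddCircle.liftIco (2 * Real.pi) 0 g, AddCircle.liftIco_zero_continuous hg0 hgc.continuousOn⟩,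
      fun x hx ↦ by
        simp only [ContinuousMap.coe_mk]
        exact AddCircle.liftIco_zero_coe_apply hx⟩
  obtain ⟨s, c, hP⟩ := WeylCircle.exists_trigPoly_approx G hε4
  -- notation
  set u : ℕ → ℝ := fun n ↦ Int.fract (α * n) with hu
  set t : ℕ → ℝ := fun n ↦ 2 * Real.pi * (α * n) with ht
  set A : ℕ → ℂ := fun n ↦ cexp (2 * Real.pi * I * ((α * γ : ℝ) : ℂ) * n) with hA
  set E : ℕ → ℂ := fun n ↦ cexp (-(γ * (2 * Real.pi * u n)) * I) with hE
  set P : ℝ → ℂ := fun x ↦ ∑ m ∈ s, c m * cexp (m * x * I) with hPdef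
  set C₀ : ℝ := ∑ m ∈ s, ‖c m‖ * (2 / ‖cexp (2 * Real.pi * I * ((α * (γ + m) : ℝ) : ℂ)) - 1‖)
    with hC₀
  -- basic facts
  have hu0 : ∀ n, 0 ≤ u n := fun n ↦ Int.fract_nonneg _
  have hu1 : ∀ n, u n < 1 := fun n ↦ Int.fract_lt_one _
  have hAn : ∀ n, ‖A n‖ = 1 := fun n ↦ by
    rw [hA]
    simp only
    rw [show (2 * Real.pi * I * ((α * γ : ℝ) : ℂ) * n : ℂ) =
      ((2 * Real.pi * (α * γ) * n : ℝ)) * I by push_cast; ring]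
    exact Complex.norm_exp_ofReal_mul_I _
  have hEn : ∀ n, ‖E n‖ = 1 := fun n ↦ by
    rw [hE]
    simp only
    rw [show (-(γ * (2 * Real.pi * u n)) * I : ℂ) =
      ((-(γ * (2 * Real.pi * u n)) : ℝ)) * I by push_cast; ring]
    exact Complex.norm_exp_ofReal_mul_I _
  have hGt : ∀ n, G ((t n : ℝ) : AddCircle (2 * Real.pi)) = g (2 * Real.pi * u n) := by
    intro n
    rw [ht, hu]
    simp only
    rw [coe_two_pi_mul_eq (α * n)]
    exact hG _ ⟨by nlinarith [hu0 n], by nlinarith [hu1 n]⟩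
  -- (iii) pointwise: `E n - G(t n)` vanishes unless `{αn} ≥ 1 - δ`, and is always `≤ 2`
  have hB3pt : ∀ n, ‖A n * (E n - G ((t n : ℝ) : AddCircle (2 * Real.pi)))‖ ≤
      2 * (if Int.fract (α * n) ∈ Set.Ico (1 - δ) 1 then 1 else 0) := by
    intro n
    rw [norm_mul, hAn, one_mul, hGt]
    by_cases hn : 1 - δ ≤ u n
    · rw [if_pos ⟨hn, hu1 n⟩, mul_one]
      calc ‖E n - g (2 * Real.pi * u n)‖ ≤ ‖E n‖ + ‖g (2 * Real.pi * u n)‖ :=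
            norm_sub_le _ _
        _ ≤ 1 + 1 := add_le_add (hEn n).le (hg_norm _ (by nlinarith [hu1 n]))
        _ = 2 := by norm_num
    · rw [if_neg (fun h ↦ hn h.1), mul_zero]
      rw [hg_eq _ (by nlinarith [not_le.mp hn]), hE]
      simp
  -- (i) the main term is a combination of geometric sums
  have hmain : ∀ N, ∑ n ∈ Icc 1 N, A n * P (t n) =
      ∑ m ∈ s, c m * ∑ n ∈ Icc 1 N, cexp (2 * Real.pi * I * ((α * (γ + m) : ℝ) : ℂ) * n) := by
    intro N
    have h1 : ∀ n ∈ Icc 1 N, A n * P (t n) =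
        ∑ m ∈ s, c m * cexp (2 * Real.pi * I * ((α * (γ + m) : ℝ) : ℂ) * n) := by
      intro n _
      rw [hPdef, hA, ht]
      simp only
      rw [Finset.mul_sum]
      refine Finset.sum_congr rfl fun m _ ↦ ?_
      rw [mul_left_comm, ← Complex.exp_add]
      congr 2
      push_cast
      ring
    rw [Finset.sum_congr rfl h1, Finset.sum_comm]
    refine Finset.sum_congr rfl fun m _ ↦ ?_
    rw [Finset.mul_sum]
  have hB1 : ∀ N, ‖∑ n ∈ Icc 1 N, A n * P (t n)‖ ≤ C₀ := by
    intro N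
    rw [hmain, hC₀]
    refine (norm_sum_le _ _).trans (Finset.sum_le_sum fun m _ ↦ ?_)
    rw [norm_mul]
    exact mul_le_mul_of_nonneg_left (norm_sum_cexp_le (fun z ↦ hres m z) N) (norm_nonneg _)
  -- the cut-off region is visited `≈ δN` times (equidistribution of `nα`)
  have hcount : Tendsto (fun N : ℕ ↦ (((Icc 1 N).filter fun n : ℕ ↦
      Int.fract (α * n) ∈ Set.Ico (1 - δ) 1).card : ℝ) / N) atTop (𝓝 δ) := by
    have := isUDModOne_mul_irrational hα (1 - δ) 1 (by linarith) (by linarith) le_rfl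
    rwa [show (1 : ℝ) - (1 - δ) = δ by ring] at this
  have hev1 : ∀ᶠ N : ℕ in atTop, (((Icc 1 N).filter fun n : ℕ ↦
      Int.fract (α * n) ∈ Set.Ico (1 - δ) 1).card : ℝ) ≤ 2 * δ * N := by
    filter_upwards [(Metric.tendsto_nhds.mp hcount) δ hδ, eventually_gt_atTop 0] with N hN hN0
    have hNr : (0 : ℝ) < N := by exact_mod_cast hN0
    rw [Real.dist_eq, abs_lt] at hN
    have h2 := (div_lt_iff₀ hNr).mp (by linarith [hN.2] : (((Icc 1 N).filter fun n : ℕ ↦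
      Int.fract (α * n) ∈ Set.Ico (1 - δ) 1).card : ℝ) / N < 2 * δ)
    linarith
  have hev2 : ∀ᶠ N : ℕ in atTop, C₀ ≤ ε' / 4 * N := by
    filter_upwards [(tendsto_natCast_atTop_atTop (R := ℝ)).eventually_ge_atTop (C₀ / (ε' / 4))]
      with N hN
    rw [div_le_iff₀ hε4] at hN
    linarith
  filter_upwards [hev1, hev2] with N hN1 hN2
  -- the decomposition at time `N`
  have hsplit : ∑ n ∈ Icc 1 N, A n * E n =
      ∑ n ∈ Icc 1 N, A n * P (t n) +
        ∑ n ∈ Icc 1 N, A n * (G ((t n : ℝ) : AddCircle (2 * Real.pi)) - P (t n)) +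
        ∑ n ∈ Icc 1 N, A n * (E n - G ((t n : ℝ) : AddCircle (2 * Real.pi))) := by
    rw [← Finset.sum_add_distrib, ← Finset.sum_add_distrib]
    exact Finset.sum_congr rfl fun n _ ↦ by ring
  have hB2 : ‖∑ n ∈ Icc 1 N, A n * (G ((t n : ℝ) : AddCircle (2 * Real.pi)) - P (t n))‖ ≤
      ε' / 4 * N := by
    refine (norm_sum_le _ _).trans ?_
    calc ∑ n ∈ Icc 1 N, ‖A n * (G ((t n : ℝ) : AddCircle (2 * Real.pi)) - P (t n))‖
        ≤ ∑ n ∈ Icc 1 N, ε' / 4 := Finset.sum_le_sum fun n _ ↦ by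
          rw [norm_mul, hAn, one_mul, hPdef]
          exact hP (t n)
      _ = ε' / 4 * N := by
          rw [Finset.sum_const, Nat.card_Icc, Nat.add_sub_cancel, nsmul_eq_mul, mul_comm]
  have hB3 : ‖∑ n ∈ Icc 1 N, A n * (E n - G ((t n : ℝ) : AddCircle (2 * Real.pi)))‖ ≤
      2 * (((Icc 1 N).filter fun n : ℕ ↦ Int.fract (α * n) ∈ Set.Ico (1 - δ) 1).card : ℝ) := by
    refine (norm_sum_le _ _).trans ?_
    refine (Finset.sum_le_sum fun n _ ↦ hB3pt n).trans ?_
    rw [← Finset.mul_sum, Finset.sum_boole]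
  have hN : (0 : ℝ) ≤ N := Nat.cast_nonneg N
  rw [Real.norm_natCast]
  show ‖∑ n ∈ Icc 1 N, A n * E n‖ ≤ ε' * N
  rw [hsplit]
  calc ‖∑ n ∈ Icc 1 N, A n * P (t n) +
        ∑ n ∈ Icc 1 N, A n * (G ((t n : ℝ) : AddCircle (2 * Real.pi)) - P (t n)) +
        ∑ n ∈ Icc 1 N, A n * (E n - G ((t n : ℝ) : AddCircle (2 * Real.pi)))‖
      ≤ ‖∑ n ∈ Icc 1 N, A n * P (t n)‖ +
        ‖∑ n ∈ Icc 1 N, A n * (G ((t n : ℝ) : AddCircle (2 * Real.pi)) - P (t n))‖ +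
        ‖∑ n ∈ Icc 1 N, A n * (E n - G ((t n : ℝ) : AddCircle (2 * Real.pi)))‖ :=
        norm_add₃_le
    _ ≤ C₀ + ε' / 4 * N + 2 * (((Icc 1 N).filter fun n : ℕ ↦
        Int.fract (α * n) ∈ Set.Ico (1 - δ) 1).card : ℝ) := add_le_add_three (hB1 N) hB2 hB3
    _ ≤ ε' / 4 * N + ε' / 4 * N + 2 * (2 * δ * N) := by gcongr
    _ ≤ ε' * N := by nlinarith

/-- **Sufficiency half of the `k = 1` criterion, Weyl-sum form.** For irrational `α` and
`β ∉ ℚ + ℚ·α⁻¹`, every Weyl sum of `[αn]β` is `o(N)`: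
`∑_{n=1}^{N} e(k[αn]β) = o(N)` (`k ∈ ℤ ∖ {0}`), via `[αn]β = αβn − {αn}β` and `weyl_core` with
`γ = kβ`. [cite: Haland1994, §1 p. 13] -/
theorem weyl_floor_mul {α β : ℝ} (hα : Irrational α)
    (hβ : β ∉ Submodule.span ℚ ({1, α⁻¹} : Set ℝ)) {k : ℤ} (hk : k ≠ 0) :
    (fun N : ℕ ↦ ∑ n ∈ Icc 1 N, cexp (2 * Real.pi * I * k * ((⌊α * n⌋ : ℝ) * β))) =o[atTop]
      fun N ↦ (N : ℝ) := by
  have hres : ∀ m z : ℤ, α * (k * β + m) ≠ z := nonresonance hα.ne_zero hβ hk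
  refine (weyl_core hα hres).congr' (Eventually.of_forall fun N ↦ ?_) EventuallyEq.rfl
  refine Finset.sum_congr rfl fun n _ ↦ ?_
  rw [← Complex.exp_add]
  congr 1
  rw [← Int.self_sub_fract (α * n)]
  push_cast
  ring

end Haland1994

/-! ### 7. The theorem -/

open Haland1994 in
/-- **Håland 1994, the case `k = 1` (p. 13; = Kuipers–Niederreiter 1974, Ch. 5 Thm 1.8),
discharged**: for irrational `α`, the sequence `[αn]β` is uniformly distributed mod 1 if and only
if `β ∉ ℚ + ℚ·α⁻¹` ("`β` rationally independent of `1, 1/α`"). Proof as printed: "the identity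
`[αn]β ≡ αβn − {αn}β (mod 1)`" — sufficiency through Weyl's criterion (`isUDModOne_of_weyl`,
`weyl_floor_mul`), necessity through the equidistribution of `nα` (`not_isUDModOne_of_mem_span`).
[cite: Haland1994, §1 p. 13] -/
theorem Haland1994_bracketLinear_iff_holds : Haland1994_bracketLinear_iff := by
  intro α β hα
  constructor
  · intro hud hmem
    exact not_isUDModOne_of_mem_span hα hmem hud
  · intro hβ
    refine isUDModOne_of_weyl _ fun k hk ↦ ?_
    refine (weyl_floor_mul hα hβ hk).congr' (Eventually.of_forall fun N ↦ ?_) EventuallyEq.rfl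
    refine Finset.sum_congr rfl fun n _ ↦ ?_
    push_cast
    ring_nf


end Literature.NumberTheory.DiophantineApproximation

end
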